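import Summits.ABC.ABC.Theses.CuspFieldPencil
import Summits.ABC.ABC.Theorems.CuspFieldPencilNFPencilReduction
import Summits.ABC.ABC.Theorems.CuspFieldPencilNFPencilLemmas
import Summits.ABC.ABC.Theorems.CuspFieldPencilGoldenFromNFPencil
import Literature.NumberTheory.DiophantineGeometry.AbcScoones2021NumberFields
import HarnessLib

/-!
# Number-field pencil theorem from Scoones 2021 (PROVED-MOD-FACT)

`Summits/ABC/ABC/Theorems/CuspFieldPencilNFPencilOfScoones.lean` — helper toward the crux
stmt-ABC-26250 `Summit.ABC.ABC.Theses.CuspFieldPencil.NFPencilBound` (draft class-record route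
`CuspFieldPencil`, LINE 17). CONDITIONAL: it derives `NFPencilBound` from the cite-only named fact
`Literature.NumberTheory.DiophantineGeometry.scoones2021_abcNumberField_classNumberOne`
(Scoones, Mathematika 70 (2023) = arXiv:2111.07791, Thm 3 + display p. 4, class-number-one ε-form;
typed ★ p610652, UNPROVED in the tree):

* `threeForms_of_scoones2021` — the case of THREE forms (registered stub `stub_threeForms`, modulo
  the fact): for pairwise non-proportional `L₀, L₁, L₂` the determinant identity
  `λ₀L₀ + λ₁L₁ + λ₂L₂ = 0` (`λ₀ = α₁β₂ − α₂β₁`, …, all `≠ 0`) gives `A₀ + A₁ + A₂ = 0`,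
  `Aᵢ = λᵢLᵢ(u,w) ≠ 0`; dividing by `g = gcd(A₀, A₁)` (PID) gives a pairwise coprime `𝓞_K`-triple
  `a + b + c = 0` to which the fact applies: `log H_K(a:b:c) ≤ C·N_K(a,b,c)^{1/3+ε}`. Bookkeeping:
  `N_K(a,b,c) ≤ N(rad(abc)) ≤ N(rad(A₀A₁A₂)) ≤ N(rad(λ₀λ₁λ₂))·G₀G₁G₂` and
  `log max(|u|,|w|) ≤ log H_K(u:w) ≤ [K:ℚ]·log 2 + log H_K(B) + log H_K(A₀:A₁)`
  (Mathlib `logHeight_linearMap_apply_le` for the INVERSE of `(u,w) ↦ (A₀,A₁)`, a fixed matrix `B`)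
  `≤ … + log H_K(A₀:A₁:A₂) = … + log H_K(a:b:c)` (projective invariance under `g`).
* `nfPencilBound_of_scoones2021` — all `k ≥ 3`, by the unconditional reduction
  `nfPencilBound_of_threeForms` (`CuspFieldPencilNFPencilReduction.lean`).

HONESTY. PROVED-MOD-FACT ≠ proved: the item stmt-ABC-26250 (unconditional as typed) stays OPEN; this
file closes nothing. CLASS RECORD at abc distance 0 (width 0); NOT abc, NOT A-PS; abc moved by 0;
typed ≠ proved; no side taken on [IUTchIII] Cor 3.12.

References: Scoones2023 (arXiv:2111.07791) Thm 3 + display p. 4 — BY NAME only; Bombieri–Gubler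
§1.5 (heights under linear maps); [folklore].
-/

set_option linter.dupNamespace false

namespace Summit.ABC.ABC.Theorems

open NumberField Height NFPencilLemmas

namespace NFPencilOfScoones

/-- Real-arithmetic assembly: from `L ≤ c₁ + C·N^e`, `N ≤ N_D·G` (naturals, `G ≥ 1`), `C ≥ 0`,
`e ≥ 0`: `L ≤ (max c₁ 0 + C·N_D^e)·G^e`. [folklore] -/
theorem real_assembly {L c₁ C e : ℝ} {N ND G : ℕ} (hC : 0 ≤ C) (he : 0 ≤ e) (hG : 1 ≤ G)
    (hL : L ≤ c₁ + C * (N : ℝ) ^ e) (hN : N ≤ ND * G) :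
    L ≤ (max c₁ 0 + C * (ND : ℝ) ^ e) * (G : ℝ) ^ e := by
  have hG1 : (1 : ℝ) ≤ G := by exact_mod_cast hG
  have hGe : 1 ≤ (G : ℝ) ^ e := Real.one_le_rpow hG1 he
  have hN' : (N : ℝ) ≤ (ND : ℝ) * (G : ℝ) := by exact_mod_cast hN
  have hNe : (N : ℝ) ^ e ≤ (ND : ℝ) ^ e * (G : ℝ) ^ e := by
    rw [← Real.mul_rpow (Nat.cast_nonneg _) (Nat.cast_nonneg _)]
    exact Real.rpow_le_rpow (Nat.cast_nonneg _) hN' he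
  have hNDe : 0 ≤ (ND : ℝ) ^ e := Real.rpow_nonneg (Nat.cast_nonneg _) e
  calc L ≤ c₁ + C * (N : ℝ) ^ e := hL
    _ ≤ max c₁ 0 * (G : ℝ) ^ e + C * ((ND : ℝ) ^ e * (G : ℝ) ^ e) := by
        gcongr
        exact (le_max_left _ _).trans (le_mul_of_one_le_right (le_max_right _ _) hGe)
    _ = (max c₁ 0 + C * (ND : ℝ) ^ e) * (G : ℝ) ^ e := by ring

/-- THREE FORMS, modulo Scoones 2021 (registered stub `stub_threeForms` of stmt-ABC-26250, CONDITIONAL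
on the cite-only named fact `scoones2021_abcNumberField_classNumberOne`): for a class-number-one
number field `K`, three pairwise non-proportional linear forms `Lᵢ = αᵢu + βᵢw` over `𝓞_K` and
`ε > 0`, there is `C` with `log max(|u|,|w|) ≤ C·(G₀G₁G₂)^{1/3+ε}` for all coprime integers `u, w`
with `L₀L₁L₂(u,w) ≠ 0`, `Gᵢ = N(rad(Lᵢ(u,w)𝓞_K))`. PROVED-MOD-FACT ≠ proved.
[cite: Scoones2023, Thm 3 + display p. 4 — by name] -/
theorem threeForms_of_scoones2021
    (hS : Literature.NumberTheory.DiophantineGeometry.scoones2021_abcNumberField_classNumberOne) :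
    ∀ (K : Type) [Field K] [NumberField K], IsPrincipalIdealRing (𝓞 K) →
      ∀ (α β : Fin 3 → 𝓞 K), (∀ i j, i ≠ j → α i * β j ≠ α j * β i) → ∀ ε : ℝ, 0 < ε →
        ∃ C : ℝ, ∀ u w : ℤ, IsCoprime u w →
          (∏ i, (α i * (u : 𝓞 K) + β i * (w : 𝓞 K))) ≠ 0 →
            Real.log ((max |u| |w| : ℤ) : ℝ) ≤ C *
              ((∏ i, Ideal.absNorm (Ideal.span {α i * (u : 𝓞 K) + β i * (w : 𝓞 K)}).radical : ℕ) : ℝ) ^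
                (1 / (3 : ℝ) + ε) := by
  intro K _ _ hPID α β hprop ε hε
  classical
  obtain ⟨C, hC0, hC⟩ := hS K hPID ε hε
  -- the determinant coefficients `λ₀, λ₁, λ₂` (all nonzero) and `D = λ₀λ₁λ₂`
  obtain ⟨l0, hl0⟩ : ∃ x : 𝓞 K, x = α 1 * β 2 - α 2 * β 1 := ⟨_, rfl⟩
  obtain ⟨l1, hl1⟩ : ∃ x : 𝓞 K, x = α 2 * β 0 - α 0 * β 2 := ⟨_, rfl⟩
  obtain ⟨l2, hl2⟩ : ∃ x : 𝓞 K, x = α 0 * β 1 - α 1 * β 0 := ⟨_, rfl⟩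
  have hl0' : l0 ≠ 0 := by rw [hl0]; exact sub_ne_zero.mpr (hprop 1 2 (by decide))
  have hl1' : l1 ≠ 0 := by rw [hl1]; exact sub_ne_zero.mpr (hprop 2 0 (by decide))
  have hl2' : l2 ≠ 0 := by rw [hl2]; exact sub_ne_zero.mpr (hprop 0 1 (by decide))
  obtain ⟨D, hD⟩ : ∃ x : 𝓞 K, x = l0 * l1 * l2 := ⟨_, rfl⟩
  have hD' : D ≠ 0 := by rw [hD]; exact mul_ne_zero (mul_ne_zero hl0' hl1') hl2'
  have hDK : (D : K) ≠ 0 := RingOfIntegers.coe_ne_zero_iff.mpr hD'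
  -- the inverse matrix of `(u, w) ↦ (λ₀L₀, λ₁L₁)` over `K`
  obtain ⟨B, hB⟩ : ∃ B : Fin 2 × Fin 2 → K, B = fun p =>
      (![![((l1 * β 1 : 𝓞 K) : K), -((l0 * β 0 : 𝓞 K) : K)],
        ![-((l1 * α 1 : 𝓞 K) : K), ((l0 * α 0 : 𝓞 K) : K)]] : Fin 2 → Fin 2 → K) p.1 p.2 / (D : K) :=
    ⟨_, rfl⟩
  set c₁ : ℝ := (totalWeight K : ℝ) * Real.log (Nat.card (Fin 2)) + logHeight B with hc₁
  set ND : ℕ := Ideal.absNorm (Ideal.span {D}).radical with hND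
  refine ⟨max c₁ 0 + C * (ND : ℝ) ^ (1 / (3 : ℝ) + ε), ?_⟩
  intro u w hcop hne
  set L : Fin 3 → 𝓞 K := fun i => α i * (u : 𝓞 K) + β i * (w : 𝓞 K) with hL
  have hLi : ∀ i, L i ≠ 0 := fun i hi => hne (Finset.prod_eq_zero (Finset.mem_univ i) hi)
  -- `A₀ + A₁ + A₂ = 0`
  obtain ⟨A0, hA0⟩ : ∃ x : 𝓞 K, x = l0 * L 0 := ⟨_, rfl⟩
  obtain ⟨A1, hA1⟩ : ∃ x : 𝓞 K, x = l1 * L 1 := ⟨_, rfl⟩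
  obtain ⟨A2, hA2⟩ : ∃ x : 𝓞 K, x = l2 * L 2 := ⟨_, rfl⟩
  have hsum : A0 + A1 + A2 = 0 := by
    rw [hA0, hA1, hA2, hl0, hl1, hl2]; simp only [hL]; ring
  have hA0' : A0 ≠ 0 := by rw [hA0]; exact mul_ne_zero hl0' (hLi 0)
  have hA1' : A1 ≠ 0 := by rw [hA1]; exact mul_ne_zero hl1' (hLi 1)
  have hA2' : A2 ≠ 0 := by rw [hA2]; exact mul_ne_zero hl2' (hLi 2)
  obtain ⟨g, a, b, c, hg, hga, hgb, hgc, ha, hb, hc, habc, hab, hbc, hca⟩ :=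
    exists_coprime_triple hA0' hA1' hA2' hsum
  have hmain := hC a b c ha hb hc habc hab hbc hca
  -- conductor bookkeeping: `N_K(a,b,c) ≤ N_D · G₀G₁G₂`
  have habc0 : a * b * c ≠ 0 := mul_ne_zero (mul_ne_zero ha hb) hc
  have hR : Literature.NumberTheory.DiophantineGeometry.radicalNorm (a : K) b c ≤
      ND * ∏ i, Ideal.absNorm (Ideal.span {L i}).radical := by
    have h1 := radicalNorm_le_absNorm_radical hPID habc0
    have hdvd : a * b * c ∣ A0 * A1 * A2 := ⟨g ^ 3, by rw [hga, hgb, hgc]; ring⟩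
    have h2 := absNorm_radical_span_le_of_dvd hdvd (mul_ne_zero (mul_ne_zero hA0' hA1') hA2')
    have heq : A0 * A1 * A2 = D * (L 0 * L 1 * L 2) := by rw [hA0, hA1, hA2, hD]; ring
    rw [heq] at h2
    have h3 := absNorm_radical_span_mul_le hD' (L 0 * L 1 * L 2)
    have h4 := absNorm_radical_span_mul_mul_le (hLi 0) (hLi 1) (L 2)
    rw [Fin.prod_univ_three]
    exact h1.trans (h2.trans (h3.trans (Nat.mul_le_mul_left _ h4)))
  -- height bookkeeping: `log max(|u|,|w|) ≤ c₁ + log H_K(a:b:c)`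
  have hH : Real.log ((max |u| |w| : ℤ) : ℝ) ≤ c₁ + logHeight ![(a : K), (b : K), (c : K)] := by
    have h1 := log_max_le_logHeight_pair K hcop
    -- `(u, w) = B (A₀, A₁)`
    have hlin : (![(u : K), (w : K)] : Fin 2 → K) = fun j => ∑ i, B (j, i) * ![(A0 : K), (A1 : K)] i := by
      have hu : (D : K) * (u : K) =
          ((l1 * β 1 : 𝓞 K) : K) * (A0 : K) - ((l0 * β 0 : 𝓞 K) : K) * (A1 : K) := by
        rw [hA0, hA1, hD, hl2]; simp only [hL, map_mul, map_add, map_sub, map_intCast]; ring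
      have hw : (D : K) * (w : K) =
          -((l1 * α 1 : 𝓞 K) : K) * (A0 : K) + ((l0 * α 0 : 𝓞 K) : K) * (A1 : K) := by
        rw [hA0, hA1, hD, hl2]; simp only [hL, map_mul, map_add, map_sub, map_intCast]; ring
      funext j
      fin_cases j
      · simp only [hB, Fin.sum_univ_two, Fin.isValue, Matrix.cons_val_zero, Matrix.cons_val_one,
          Matrix.cons_val_fin_one, Fin.zero_eta]
        field_simp
        linear_combination hu
      · simp only [hB, Fin.sum_univ_two, Fin.isValue, Matrix.cons_val_zero, Matrix.cons_val_one,
          Matrix.cons_val_fin_one, Fin.mk_one]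
        field_simp
        linear_combination hw
    have h2 := logHeight_linearMap_apply_le B ![(A0 : K), (A1 : K)]
    rw [← hlin] at h2
    -- `H(A₀:A₁) ≤ H(A₀:A₁:A₂) = H(a:b:c)`
    have h3 : logHeight ![(A0 : K), (A1 : K)] ≤ logHeight ![(A0 : K), (A1 : K), (A2 : K)] := by
      have := logHeight_comp_le (![0, 1] : Fin 2 → Fin 3) ![(A0 : K), (A1 : K), (A2 : K)]
      convert this using 2
      funext j; fin_cases j <;> rfl
    have h4 : logHeight ![(A0 : K), (A1 : K), (A2 : K)] = logHeight ![(a : K), (b : K), (c : K)] := by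
      have hgK : (g : K) ≠ 0 := RingOfIntegers.coe_ne_zero_iff.mpr hg
      rw [← logHeight_smul_eq_logHeight ![(a : K), (b : K), (c : K)] hgK]
      congr 1
      funext j; fin_cases j <;> simp [hga, hgb, hgc]
    linarith [h1, h2, h3, h4.le, h4.ge]
  -- assembly
  have hG1 : 1 ≤ ∏ i, Ideal.absNorm (Ideal.span {L i}).radical := by
    refine Finset.one_le_prod' fun i _ => Nat.one_le_iff_ne_zero.mpr ?_
    rw [Ne, Ideal.absNorm_eq_zero_iff]
    intro h
    exact hLi i (Ideal.span_singleton_eq_bot.mp (le_bot_iff.mp (Ideal.le_radical.trans h.le)))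
  exact real_assembly hC0.le (by positivity) hG1 (by linarith [hmain, hH]) hR

end NFPencilOfScoones

/-- **X1-from-fact (KEY CUSPFIELD-NF-PENCIL item (5); PROVED-MOD-FACT ≠ proved).** The parametric
number-field pencil theorem `NFPencilBound` (crux stmt-ABC-26250 of route `CuspFieldPencil`, which
stays OPEN as typed — it is unconditional) follows from the cite-only named fact
`scoones2021_abcNumberField_classNumberOne` (Scoones 2021/2023, Thm 3 + display; unproved in the
tree): three forms by `threeForms_of_scoones2021`, `k ≥ 4` by the unconditional min-triple reduction
`nfPencilBound_of_threeForms`. NOT abc, NOT A-PS; abc moved by 0.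
[cite: Scoones2023, Thm 3 + display p. 4 — by name] -/
theorem nfPencilBound_of_scoones2021
    (hS : Literature.NumberTheory.DiophantineGeometry.scoones2021_abcNumberField_classNumberOne) :
    Summit.ABC.ABC.Theses.CuspFieldPencil.NFPencilBound :=
  nfPencilBound_of_threeForms (NFPencilOfScoones.threeForms_of_scoones2021 hS)

/-- Corollary (PROVED-MOD-FACT): the golden cusp shadow X1 `GoldenCuspShadow` (stmt-ABC-26026) modulo the
Scoones fact, by the landed glue `GoldenCuspShadowGlue` and golden instance `GoldenFromNFPencil`.
NOT abc, NOT A-PS; abc moved by 0. [cite: Scoones2023, Thm 3 + display p. 4 — by name] -/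
theorem goldenCuspShadow_of_scoones2021
    (hS : Literature.NumberTheory.DiophantineGeometry.scoones2021_abcNumberField_classNumberOne) :
    Summit.ABC.ABC.Theses.CuspFieldPencil.GoldenCuspShadow := by
  have h := nfPencilBound_of_scoones2021 hS
  exact (show Summit.ABC.ABC.Theses.CuspFieldPencil.GoldenFromNFPencil from
    Summit.ABC.ABC.Theorems.goldenFromNFPencil_proof) h

end Summit.ABC.ABC.Theorems
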